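import Summits.QuantumFields.YangMills.Theorems.ColdStartUniversalityLatticeLangevinConditionalGreenKuboSharp
import Summits.QuantumFields.YangMills.Theorems.ColdStartUniversalityLatticeLangevinCorrectorIncrements
import Summits.QuantumFields.YangMills.Theorems.ColdStartUniversalityLatticeLangevinSplice
import HarnessLib

/-!
# Route `ColdStartUniversality` (fixed-cut-off SZZ dynamics, sampler package): THE BLOCK INCREMENTS OF THE POISSON MARTINGALE —
# orthogonal to the past and with predictable variance `b·σ²(G)` up to `O(√b)`: `|E[Z(D_k² − bσ²)]| ≤ η_b E[Z]`

Helper file (seat `ym-line-csu-p1`, g35; `--supports stmt-QuantumFields-24809`).  Input of the central limit theorem for TIME AVERAGES of the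
cold-start sampler (next files).  For the SU(2) SZZ dynamics at any coupling, a realising kernel family `κ`, a continuous `|G| ≤ 1` with
`Ĝ = G − μ_(β')G`, a bounded measurable mild corrector `u` (`|u| ≤ β_u`, `κ_s u − u = −∫₀ˢ κ_r Ĝ dr`, file `…PoissonEquation`), a progressively
measurable strong solution `U` from a deterministic start on ANY space and a block length `b > 0`, the increments of file 81
`D_k = u(U_((k+1)b)) − u(U_(kb)) + ∫_(kb,(k+1)b] Ĝ(U_r) dr` satisfy, besides adaptedness, `|D_k| ≤ 2β_u + 2b`, orthogonality to the past and
telescoping (re-exported), the PREDICTABLE-VARIANCE ESTIMATE (★★ `exists_blockIncrements`)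

  `|E[Z · (D_k² − b σ²)]| ≤ η_b · E[Z]`,  `σ² = 2∫₀^∞ ⟨Ĝ, κ_tĜ⟩_μ dt`,  `η_b = K + 2β_u((b|σ²| + K)/√(1+b) + √(1+b)) + 4β_u² = O(√b)`,

for every bounded non-negative `𝓕^W_(kb)`-measurable weight `Z` — from the sharp conditional Green–Kubo formula of file 85s
(`|E[Z I_k²] − bσ² E[Z]| ≤ K E[Z]` for the block integral `I_k`), `D_k = I_k + Δ_k` with `|Δ_k| ≤ 2β_u`, and `2|I| ≤ εI² + ε⁻¹` with
`ε = (1+b)^(−1/2)`.  Since `η_b/b → 0`, blocks of growing length have asymptotically deterministic conditional variance — the Bernstein-block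
mechanism of the time-average CLT.  THEOREMS ONLY, no definition, no sorry; [folklore].  HONEST FRAMING: fixed cut-off; `K` depends on `L, β'`;
`UniformColdStartMixing` (24809) is NOT restated; no crux, rung or summit statement is proved; the Yang–Mills mass gap is NOT proved.
-/

set_option autoImplicit false

noncomputable section

namespace Summit.QuantumFields.YangMills.Theorems.ColdStartUniversality

open MeasureTheory ProbabilityTheory Filter Topology Set
open scoped NNReal ENNReal BigOperators
open Literature Literature.Probability.Process Literature.MathematicalPhysics.QuantumFieldTheory
open Literature.MathematicalPhysics.QuantumLattice (fundamentalRep fundamentalLatticeRep continuous_fundamentalRep)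

variable {L : ℕ} [NeZero L]

/-- ★★ **Block increments of the Poisson martingale: adapted, bounded, orthogonal to the past, predictable variance `bσ²` up to `η_b = O(√b)`,
telescoping.**  See the module docstring. [folklore] -/
theorem exists_blockIncrements (L : ℕ) [NeZero L] (β' : ℝ) :
    ∃ K : ℝ, 0 ≤ K ∧
      ∀ (κ : ℝ≥0 → Kernel (GaugeConfig 3 L (Matrix.specialUnitaryGroup (Fin 2) ℂ))
          (GaugeConfig 3 L (Matrix.specialUnitaryGroup (Fin 2) ℂ))) [∀ t, IsMarkovKernel (κ t)],
        (∀ (t : ℝ≥0) (x : GaugeConfig 3 L (Matrix.specialUnitaryGroup (Fin 2) ℂ))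
          (Ω : Type) [MeasurableSpace Ω] (P : Measure Ω) [IsProbabilityMeasure P]
          (W : ℝ≥0 → Ω → (Edge 3 L × NoiseIdx 2 → ℝ)) (hW : IsFlatBrownian W P)
          (U : ℝ≥0 → Ω → GaugeConfig 3 L (Matrix.specialUnitaryGroup (Fin 2) ℂ)),
          (∀ ω, U 0 ω = x) →
          (latticeLangevinDynamics (fundamentalLatticeRep 2) β').IsSolution (fundamentalRep (Fin 2))
            hW.natFiltration P W U →
          κ t x = P.map (U t)) →
        ∀ (x : GaugeConfig 3 L (Matrix.specialUnitaryGroup (Fin 2) ℂ))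
          (Ω : Type) [MeasurableSpace Ω] (P : Measure Ω) [IsProbabilityMeasure P]
          (W : ℝ≥0 → Ω → (Edge 3 L × NoiseIdx 2 → ℝ)) (hW : IsFlatBrownian W P)
          (U : ℝ≥0 → Ω → GaugeConfig 3 L (Matrix.specialUnitaryGroup (Fin 2) ℂ)),
          (∀ ω, U 0 ω = x) →
          (latticeLangevinDynamics (fundamentalLatticeRep 2) β').IsSolution (fundamentalRep (Fin 2)) hW.natFiltration P W U →
          (∀ i : ℝ≥0, Measurable[@Prod.instMeasurableSpace (Set.Iic i) Ω inferInstance (hW.natFiltration i)]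
            (fun q : Set.Iic i × Ω => U q.1 q.2)) →
        ∀ (G : GaugeConfig 3 L (Matrix.specialUnitaryGroup (Fin 2) ℂ) → ℝ), Continuous G → (∀ z, |G z| ≤ 1) →
        ∀ (u : GaugeConfig 3 L (Matrix.specialUnitaryGroup (Fin 2) ℂ) → ℝ), Measurable u → ∀ (βu : ℝ), (∀ y, |u y| ≤ βu) →
          (∀ (s : ℝ≥0) (y : GaugeConfig 3 L (Matrix.specialUnitaryGroup (Fin 2) ℂ)),
            (∫ z, u z ∂(κ s y)) - u y = -∫ t in (0 : ℝ)..(s : ℝ),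
              (∫ z, (G z - ∫ z', G z' ∂(wilsonMeasure (d := 3) (L := L) (fundamentalRep (Fin 2)) β')) ∂(κ t.toNNReal y))) →
        ∀ (b : ℝ), 0 < b →
          ∃ D : ℕ → Ω → ℝ,
            (∀ k, Measurable[hW.natFiltration ((((k + 1 : ℕ) : ℝ) * b).toNNReal)] (D k)) ∧
            (∀ k ω, |D k ω| ≤ 2 * βu + 2 * b) ∧
            (∀ (k : ℕ) (Z : Ω → ℝ), Measurable[hW.natFiltration (((k : ℝ) * b).toNNReal)] Z → (∀ ω, 0 ≤ Z ω) →
              (∃ CZ : ℝ, ∀ ω, Z ω ≤ CZ) → ∫ ω, Z ω * D k ω ∂P = 0) ∧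
            (∀ (k : ℕ) (Z : Ω → ℝ), Measurable[hW.natFiltration (((k : ℝ) * b).toNNReal)] Z → (∀ ω, 0 ≤ Z ω) →
              (∃ CZ : ℝ, ∀ ω, Z ω ≤ CZ) →
              |∫ ω, Z ω * (D k ω ^ 2 - b * (2 * ∫ t in Ioi (0 : ℝ),
                  (∫ y, (G y - ∫ z, G z ∂(wilsonMeasure (d := 3) (L := L) (fundamentalRep (Fin 2)) β')) *
                    (∫ z, (G z - ∫ z', G z' ∂(wilsonMeasure (d := 3) (L := L) (fundamentalRep (Fin 2)) β')) ∂(κ t.toNNReal y))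
                    ∂(wilsonMeasure (d := 3) (L := L) (fundamentalRep (Fin 2)) β')))) ∂P| ≤
                (K + 2 * βu * ((b * |2 * ∫ t in Ioi (0 : ℝ),
                  (∫ y, (G y - ∫ z, G z ∂(wilsonMeasure (d := 3) (L := L) (fundamentalRep (Fin 2)) β')) *
                    (∫ z, (G z - ∫ z', G z' ∂(wilsonMeasure (d := 3) (L := L) (fundamentalRep (Fin 2)) β')) ∂(κ t.toNNReal y))
                    ∂(wilsonMeasure (d := 3) (L := L) (fundamentalRep (Fin 2)) β'))| + K) / Real.sqrt (1 + b) + Real.sqrt (1 + b)) +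
                  4 * βu ^ 2) * ∫ ω, Z ω ∂P) ∧
            (∀ (n : ℕ) ω, ∑ k ∈ Finset.range n, D k ω = u (U (((n : ℝ) * b).toNNReal) ω) - u x +
              ∫ r in Ioc (0 : ℝ) (n * b), (G (U r.toNNReal ω) - ∫ z', G z' ∂(wilsonMeasure (d := 3) (L := L) (fundamentalRep (Fin 2)) β'))) := by
  classical
  haveI := secondCountableTopology_su2
  haveI := borelSpace_config L
  obtain ⟨K, hK, hGK⟩ := abs_integral_mul_sq_blockIntegral_sub_le_integral L β'
  refine ⟨K, hK, fun κ _ hreal x Ω _ P _ W hW U hU0 hU hprog G hGc hG1 u hum βu hub hPois b hb => ?_⟩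
  set μ : Measure (GaugeConfig 3 L (Matrix.specialUnitaryGroup (Fin 2) ℂ)) :=
    wilsonMeasure (d := 3) (L := L) (fundamentalRep (Fin 2)) β' with hμ
  haveI : IsProbabilityMeasure μ :=
    isProbabilityMeasure_wilsonMeasure (d := 3) (L := L) (fundamentalRep (Fin 2)) (continuous_fundamentalRep (Fin 2)) β'
  set m : ℝ := ∫ z, G z ∂μ with hm
  have hG : Measurable G := hGc.measurable
  have hm1 : |m| ≤ 1 := by
    have hh := norm_integral_le_of_norm_le_const (μ := μ) (f := G) (C := 1)
      (Eventually.of_forall fun z => by simpa [Real.norm_eq_abs] using hG1 z)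
    simpa [Real.norm_eq_abs] using hh
  set Gh : GaugeConfig 3 L (Matrix.specialUnitaryGroup (Fin 2) ℂ) → ℝ := fun z => G z - m with hGh
  have hGhm : Measurable Gh := hG.sub measurable_const
  have hGhb : ∀ z, |Gh z| ≤ 2 := fun z => by
    show |G z - m| ≤ 2
    have := abs_sub (G z) m
    linarith [hG1 z]
  set σ2 : ℝ := 2 * ∫ t in Ioi (0 : ℝ), (∫ y, Gh y * (∫ z, Gh z ∂(κ t.toNNReal y)) ∂μ) with hσ2
  set S : ℝ := |σ2| with hS
  have hβ0 : 0 ≤ βu := (abs_nonneg _).trans (hub x)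
  have hmU : ∀ s : ℝ≥0, Measurable (U s) := fun s => (hU.adapted s).mono (hW.natFiltration.le s) le_rfl
  -- joint measurability of the progressively measurable solution
  have hJm : Measurable fun q : Ω × ℝ => U q.2.toNNReal q.1 :=
    measurable_uncurry_of_prog (Z := U) (fun n : ℕ => hW.natFiltration n) (fun n => hW.natFiltration.le n) (fun n => hprog n)
  have hUj : Measurable (Function.uncurry U) := by
    have h3 : Measurable fun p : ℝ≥0 × Ω => (p.2, (p.1 : ℝ)) := measurable_snd.prodMk (measurable_fst.coe_nnreal_real)
    have h4 := hJm.comp h3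
    have hfun : (Function.uncurry U) = (fun q : Ω × ℝ => U q.2.toNNReal q.1) ∘ (fun p : ℝ≥0 × Ω => (p.2, (p.1 : ℝ))) := by
      funext p; simp [Function.uncurry, Real.toNNReal_coe]
    rw [hfun]; exact h4
  have hpath : ∀ ω, Measurable fun r : ℝ => Gh (U r.toNNReal ω) := fun ω =>
    hGhm.comp (hJm.comp (measurable_const.prodMk measurable_id))
  /- ### 1. The increments of file 81 -/
  obtain ⟨D, hDF, hDb, horth, htel⟩ := exists_correctorIncrements β' κ hreal hGc hG1 hum hub hPois x hW hU0 hU hprog hb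
  /- ### 2. The block integrals `I_k` and `D_k = I_k + Δ_k` -/
  set I : ℕ → Ω → ℝ := fun k ω => ∫ r in Ioc ((k : ℝ) * b) ((k : ℝ) * b + b), Gh (U r.toNNReal ω) with hI
  have hk0 : ∀ k : ℕ, (0 : ℝ) ≤ (k : ℝ) * b := fun k => by positivity
  have hIb : ∀ k ω, |I k ω| ≤ 2 * b := fun k ω => by
    have hh := norm_setIntegral_le_of_norm_le_const (μ := volume) (s := Ioc ((k : ℝ) * b) ((k : ℝ) * b + b)) measure_Ioc_lt_top
      (fun r _ => show ‖Gh (U r.toNNReal ω)‖ ≤ 2 by rw [Real.norm_eq_abs]; exact hGhb _) (f := fun r => Gh (U r.toNNReal ω))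
    rw [Real.norm_eq_abs, Real.volume_real_Ioc_of_le (by linarith)] at hh
    calc |I k ω| ≤ 2 * ((k : ℝ) * b + b - (k : ℝ) * b) := hh
      _ = 2 * b := by ring
  have hDI : ∀ k ω, D k ω = I k ω + (u (U ((((k + 1 : ℕ) : ℝ) * b).toNNReal) ω) - u (U (((k : ℝ) * b).toNNReal) ω)) := by
    intro k ω
    have h1 := htel (k + 1) ω
    have h2 := htel k ω
    rw [Finset.sum_range_succ, h2] at h1
    -- split `∫_(0,(k+1)b] = ∫_(0,kb] + ∫_(kb,(k+1)b]`
    have hio : IntegrableOn (fun r : ℝ => Gh (U r.toNNReal ω)) (Ioc (0 : ℝ) (((k + 1 : ℕ) : ℝ) * b)) volume :=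
      (integrableOn_const (C := (2 : ℝ)) (hs := measure_Ioc_lt_top.ne)).mono' (hpath ω).aestronglyMeasurable
        (Eventually.of_forall fun r => by rw [Real.norm_eq_abs]; exact hGhb _)
    have hsplit : ∫ r in Ioc (0 : ℝ) (((k + 1 : ℕ) : ℝ) * b), Gh (U r.toNNReal ω) =
        (∫ r in Ioc (0 : ℝ) ((k : ℝ) * b), Gh (U r.toNNReal ω)) + ∫ r in Ioc ((k : ℝ) * b) ((k : ℝ) * b + b), Gh (U r.toNNReal ω) := by
      have hkb : ((k : ℝ) * b + b) = (((k + 1 : ℕ) : ℝ) * b) := by push_cast; ring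
      rw [← hkb]
      have hun : Ioc (0 : ℝ) ((k : ℝ) * b + b) = Ioc (0 : ℝ) ((k : ℝ) * b) ∪ Ioc ((k : ℝ) * b) ((k : ℝ) * b + b) :=
        (Ioc_union_Ioc_eq_Ioc (hk0 k) (by linarith)).symm
      rw [hun, setIntegral_union (Ioc_disjoint_Ioc_of_le le_rfl) measurableSet_Ioc]
      · exact hio.mono_set (by rw [← hkb]; exact Ioc_subset_Ioc_right (by linarith))
      · exact hio.mono_set (by rw [← hkb]; exact Ioc_subset_Ioc_left (hk0 k))
    have hcast : ((((k + 1 : ℕ) : ℝ)) * b) = ((k + 1 : ℕ) : ℝ) * b := rfl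
    simp only [hI]
    have h1' : ∑ x ∈ Finset.range k, D x ω + D k ω = u (U ((((k + 1 : ℕ) : ℝ) * b).toNNReal) ω) - u x +
        ((∫ r in Ioc (0 : ℝ) ((k : ℝ) * b), Gh (U r.toNNReal ω)) + ∫ r in Ioc ((k : ℝ) * b) ((k : ℝ) * b + b), Gh (U r.toNNReal ω)) := by
      rw [← hsplit]; convert h1 using 3
    linarith
  /- ### 3. Conditional Green–Kubo for `I_k` with a past weight -/
  have hblk : ∀ (k : ℕ) (Z : Ω → ℝ), Measurable[hW.natFiltration (((k : ℝ) * b).toNNReal)] Z → (∀ ω, 0 ≤ Z ω) → ∀ CZ : ℝ, (∀ ω, Z ω ≤ CZ) →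
      |(∫ ω, Z ω * I k ω ^ 2 ∂P) - b * σ2 * ∫ ω, Z ω ∂P| ≤ K * ∫ ω, Z ω ∂P := by
    intro k Z hZF hZ0 CZ hZb
    have h := hGK κ hreal x Ω P W hW U hU0 hU hUj G hGc hG1 (((k : ℝ) * b).toNNReal) b hb.le Z hZF hZ0 CZ hZb
    have hs : (((((k : ℝ) * b).toNNReal : ℝ≥0)) : ℝ) = (k : ℝ) * b := Real.coe_toNNReal _ (hk0 k)
    have heq : (∫ ω, Z ω * (∫ r in Ioc (((((k : ℝ) * b).toNNReal : ℝ≥0)) : ℝ) ((((((k : ℝ) * b).toNNReal : ℝ≥0)) : ℝ) + b),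
        Gh (U r.toNNReal ω)) ^ 2 ∂P) = ∫ ω, Z ω * I k ω ^ 2 ∂P :=
      integral_congr_ae (ae_of_all _ fun ω => by dsimp only; rw [hs])
    rw [heq] at h
    have hσ : 2 * b * (∫ t in Ioi (0 : ℝ), (∫ y, Gh y * (∫ z, Gh z ∂(κ t.toNNReal y)) ∂μ)) = b * σ2 := by rw [hσ2]; ring
    rw [hσ] at h
    exact h
  /- ### 4. The predictable-variance estimate -/
  refine ⟨D, hDF, hDb, horth, fun k Z hZF hZ0 hZb => ?_, htel⟩
  obtain ⟨CZ, hCZ⟩ := hZb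
  have hZm : Measurable Z := hZF.mono (hW.natFiltration.le _) le_rfl
  have hZabs : ∀ ω, |Z ω| ≤ CZ := fun ω => by rw [abs_of_nonneg (hZ0 ω)]; exact hCZ ω
  have hC0 : 0 ≤ CZ := (hZ0 (Classical.choice (nonempty_of_isProbabilityMeasure P))).trans (hCZ _)
  have hEZ0 : 0 ≤ ∫ ω, Z ω ∂P := integral_nonneg hZ0
  have h85 := hblk k Z hZF hZ0 CZ hCZ
  -- the pieces `Δ_k`, bounded by `2β_u`
  set Δ : Ω → ℝ := fun ω => u (U ((((k + 1 : ℕ) : ℝ) * b).toNNReal) ω) - u (U (((k : ℝ) * b).toNNReal) ω) with hΔ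
  have hΔm : Measurable Δ := (hum.comp (hmU _)).sub (hum.comp (hmU _))
  have hΔb : ∀ ω, |Δ ω| ≤ 2 * βu := fun ω => (abs_sub _ _).trans (by linarith [hub (U ((((k + 1 : ℕ) : ℝ) * b).toNNReal) ω), hub (U (((k : ℝ) * b).toNNReal) ω)])
  have hDm : Measurable (D k) := (hDF k).mono (hW.natFiltration.le _) le_rfl
  have hIm : Measurable (I k) := by
    have : I k = fun ω => D k ω - Δ ω := funext fun ω => by rw [hDI]; simp only [hΔ]; ring
    rw [this]; exact hDm.sub hΔm
  -- integrability of the bounded measurable pieces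
  have hInt : ∀ {φ : Ω → ℝ} {Cφ : ℝ}, Measurable φ → (∀ ω, |φ ω| ≤ Cφ) → Integrable (fun ω => Z ω * φ ω) P :=
    fun {φ Cφ} hφ hφb => (integrable_const (CZ * Cφ)).mono' (hZm.mul hφ).aestronglyMeasurable
      (Eventually.of_forall fun ω => by
        rw [norm_mul, Real.norm_eq_abs, Real.norm_eq_abs, abs_of_nonneg (hZ0 ω)]
        exact mul_le_mul (hCZ ω) (hφb ω) (abs_nonneg _) hC0)
  have hI2b : ∀ ω, |I k ω ^ 2| ≤ (2 * b) ^ 2 := fun ω => by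
    rw [abs_of_nonneg (sq_nonneg _), ← sq_abs]; exact pow_le_pow_left₀ (abs_nonneg _) (hIb k ω) 2
  have iZI2 : Integrable (fun ω => Z ω * I k ω ^ 2) P := hInt (hIm.pow_const 2) hI2b
  have iZIabs : Integrable (fun ω => Z ω * |I k ω|) P := hInt hIm.abs fun ω => by rw [abs_abs]; exact hIb k ω
  have iZIΔ : Integrable (fun ω => Z ω * (I k ω * Δ ω)) P := hInt (hIm.mul hΔm) fun ω => by
    rw [abs_mul]; exact mul_le_mul (hIb k ω) (hΔb ω) (abs_nonneg _) (by positivity)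
  have iZΔ2 : Integrable (fun ω => Z ω * Δ ω ^ 2) P := hInt (hΔm.pow_const 2) fun ω => by
    rw [abs_of_nonneg (sq_nonneg _), ← sq_abs]; exact pow_le_pow_left₀ (abs_nonneg _) (hΔb ω) 2
  have iZ : Integrable Z P := by
    have h := hInt (measurable_const (a := (1 : ℝ))) (fun _ => (abs_one.le : |(1 : ℝ)| ≤ 1))
    simpa using h
  -- `E[Z I²] ≤ (b|σ²| + K) E[Z]`
  have hZI2 : ∫ ω, Z ω * I k ω ^ 2 ∂P ≤ (b * S + K) * ∫ ω, Z ω ∂P := by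
    have h1 := (abs_le.1 h85).2
    have h2 : b * σ2 * ∫ ω, Z ω ∂P ≤ b * S * ∫ ω, Z ω ∂P :=
      mul_le_mul_of_nonneg_right (mul_le_mul_of_nonneg_left (le_abs_self _) hb.le) hEZ0
    linarith
  -- `2 E[Z|I|] ≤ ε E[Z I²] + ε⁻¹ E[Z]` with `ε = (1+b)^(−1/2)`
  set ε : ℝ := (Real.sqrt (1 + b))⁻¹ with hε
  have hsq : 0 < Real.sqrt (1 + b) := Real.sqrt_pos.2 (by linarith)
  have hε0 : 0 < ε := inv_pos.2 hsq
  have hZIabs : 2 * ∫ ω, Z ω * |I k ω| ∂P ≤ ε * ∫ ω, Z ω * I k ω ^ 2 ∂P + ε⁻¹ * ∫ ω, Z ω ∂P := by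
    rw [← integral_const_mul, ← integral_const_mul, ← integral_const_mul, ← integral_add ((iZI2.const_mul ε)) (iZ.const_mul _)]
    refine integral_mono (iZIabs.const_mul 2) ((iZI2.const_mul ε).add (iZ.const_mul _)) fun ω => ?_
    have hamgm : 2 * |I k ω| ≤ ε * I k ω ^ 2 + ε⁻¹ := by
      have h1 : 0 ≤ ε * (|I k ω| - ε⁻¹) ^ 2 := by positivity
      have h2 : ε * (|I k ω| - ε⁻¹) ^ 2 = ε * I k ω ^ 2 - 2 * |I k ω| + ε⁻¹ := by
        rw [sub_sq, sq_abs]; field_simp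
      linarith
    have := mul_le_mul_of_nonneg_left hamgm (hZ0 ω)
    nlinarith [this]
  -- assemble: `Z(D² − bσ²) = Z(I² − bσ²) + 2 Z I Δ + Z Δ²`
  have hpt : ∀ ω, Z ω * (D k ω ^ 2 - b * σ2) = (Z ω * I k ω ^ 2 - b * σ2 * Z ω) + 2 * (Z ω * (I k ω * Δ ω)) + Z ω * Δ ω ^ 2 := fun ω => by
    rw [hDI]; simp only [hΔ]; ring
  have i1 : Integrable (fun ω => Z ω * I k ω ^ 2 - b * σ2 * Z ω) P := iZI2.sub (iZ.const_mul _)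
  have i2 : Integrable (fun ω => 2 * (Z ω * (I k ω * Δ ω))) P := iZIΔ.const_mul 2
  have i12 : Integrable (fun ω => (Z ω * I k ω ^ 2 - b * σ2 * Z ω) + 2 * (Z ω * (I k ω * Δ ω))) P := i1.add i2
  rw [integral_congr_ae (ae_of_all _ hpt), integral_add i12 iZΔ2, integral_add i1 i2, integral_sub iZI2 (iZ.const_mul _),
    integral_const_mul, integral_const_mul]
  have hA : |(∫ ω, Z ω * I k ω ^ 2 ∂P) - b * σ2 * ∫ ω, Z ω ∂P| ≤ K * ∫ ω, Z ω ∂P := h85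
  have hB : |2 * ∫ ω, Z ω * (I k ω * Δ ω) ∂P| ≤ 2 * βu * ((b * S + K) / Real.sqrt (1 + b) + Real.sqrt (1 + b)) * ∫ ω, Z ω ∂P := by
    have h1 : |∫ ω, Z ω * (I k ω * Δ ω) ∂P| ≤ 2 * βu * ∫ ω, Z ω * |I k ω| ∂P := by
      rw [← integral_const_mul]
      refine (abs_integral_le_integral_abs).trans (integral_mono iZIΔ.abs (iZIabs.const_mul _) fun ω => ?_)
      rw [abs_mul, abs_of_nonneg (hZ0 ω), abs_mul]
      calc Z ω * (|I k ω| * |Δ ω|) ≤ Z ω * (|I k ω| * (2 * βu)) :=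
            mul_le_mul_of_nonneg_left (mul_le_mul_of_nonneg_left (hΔb ω) (abs_nonneg _)) (hZ0 ω)
        _ = 2 * βu * (Z ω * |I k ω|) := by ring
    have h2 : 2 * ∫ ω, Z ω * |I k ω| ∂P ≤ ((b * S + K) / Real.sqrt (1 + b) + Real.sqrt (1 + b)) * ∫ ω, Z ω ∂P := by
      calc 2 * ∫ ω, Z ω * |I k ω| ∂P ≤ ε * ∫ ω, Z ω * I k ω ^ 2 ∂P + ε⁻¹ * ∫ ω, Z ω ∂P := hZIabs
        _ ≤ ε * ((b * S + K) * ∫ ω, Z ω ∂P) + ε⁻¹ * ∫ ω, Z ω ∂P := by gcongr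
        _ = ((b * S + K) / Real.sqrt (1 + b) + Real.sqrt (1 + b)) * ∫ ω, Z ω ∂P := by
            simp only [hε, inv_inv]; ring
    rw [abs_mul, abs_two]
    calc 2 * |∫ ω, Z ω * (I k ω * Δ ω) ∂P| ≤ 2 * (2 * βu * ∫ ω, Z ω * |I k ω| ∂P) := by linarith
      _ = 2 * βu * (2 * ∫ ω, Z ω * |I k ω| ∂P) := by ring
      _ ≤ 2 * βu * (((b * S + K) / Real.sqrt (1 + b) + Real.sqrt (1 + b)) * ∫ ω, Z ω ∂P) :=
          mul_le_mul_of_nonneg_left h2 (by positivity)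
      _ = 2 * βu * ((b * S + K) / Real.sqrt (1 + b) + Real.sqrt (1 + b)) * ∫ ω, Z ω ∂P := by ring
  have hC : |∫ ω, Z ω * Δ ω ^ 2 ∂P| ≤ 4 * βu ^ 2 * ∫ ω, Z ω ∂P := by
    rw [abs_of_nonneg (integral_nonneg fun ω => mul_nonneg (hZ0 ω) (sq_nonneg _)), ← integral_const_mul]
    refine integral_mono iZΔ2 (iZ.const_mul _) fun ω => ?_
    have h1 : Δ ω ^ 2 ≤ (2 * βu) ^ 2 := by rw [← sq_abs]; exact pow_le_pow_left₀ (abs_nonneg _) (hΔb ω) 2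
    calc Z ω * Δ ω ^ 2 ≤ Z ω * (2 * βu) ^ 2 := mul_le_mul_of_nonneg_left h1 (hZ0 ω)
      _ = 4 * βu ^ 2 * Z ω := by ring
  calc |(∫ ω, Z ω * I k ω ^ 2 ∂P) - b * σ2 * ∫ ω, Z ω ∂P + 2 * ∫ ω, Z ω * (I k ω * Δ ω) ∂P + ∫ ω, Z ω * Δ ω ^ 2 ∂P|
      ≤ |(∫ ω, Z ω * I k ω ^ 2 ∂P) - b * σ2 * ∫ ω, Z ω ∂P| + |2 * ∫ ω, Z ω * (I k ω * Δ ω) ∂P| + |∫ ω, Z ω * Δ ω ^ 2 ∂P| := abs_add_three _ _ _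
    _ ≤ K * ∫ ω, Z ω ∂P + 2 * βu * ((b * S + K) / Real.sqrt (1 + b) + Real.sqrt (1 + b)) * ∫ ω, Z ω ∂P + 4 * βu ^ 2 * ∫ ω, Z ω ∂P :=
        add_le_add (add_le_add hA hB) hC
    _ = (K + 2 * βu * ((b * S + K) / Real.sqrt (1 + b) + Real.sqrt (1 + b)) + 4 * βu ^ 2) * ∫ ω, Z ω ∂P := by ring

end Summit.QuantumFields.YangMills.Theorems.ColdStartUniversality

end
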